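import Literature.NumberTheory.EllipticCurves.PrimeLevelEigenpacketNewformProofs
import HarnessLib

/-!
# The `p`-stabilisation of an eigenform on `Γ₁(N)` (`p ∤ N`): a `U_p`-eigenform on `Γ₁(Np)`
# (proofs only)

Topic `Literature/NumberTheory/EllipticCurves`; namespace
`Literature.NumberTheory.EllipticCurves.ModularForms`.  THEOREMS ONLY (no definition, no named
fact; D-0026).  The `Γ₁(N)` companion, in every weight `k`, of the tree's `Γ₀(N)` statement
`exists_ordinary_pStabilised_of_isNewform0` (`HidaFamilyMembersProofs`, `k > 2`).

Let `f ∈ S_k(Γ₁(N))` lie in the `χ`-eigenspace of the diamond operators and be an eigenvector of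
`T_p`, `T_p f = a f`, for a prime `p ∤ N`; let `β` be a root of the Hecke polynomial
`X² - a X + χ(p) p^{k-1}` and put `α = a - β` (the other root).  The **`p`-stabilisation**

  `F = [α_1]_k f - β p^{1-k} [α_p]_k f ∈ S_k(Γ₁(Np))`

(`[α_d]_k = degeneracyMap1 N (Np) d k`, so that `[α_p]_k f = p^{k-1} f(pτ)` and
`F(τ) = f(τ) - β f(pτ)`; Wiles, Invent. Math. 94 (1988), p. 538: "replace `f₁` with the
`v`-stabilized eigenform"; Diamond–Shurman Prop. 5.6.2, second diagram; Hida, *Elementary theory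
of L-functions and Eisenstein series*, §7.2, p. 210) satisfies

* `heckeT_pStabilised` — `U_p F = α F`;
* `heckeT_pStabilised_of_not_dvd` — `T_q F = b F` whenever `T_q f = b f`, for primes `q ∤ Np`
  (`U_q` for `q ∣ N` as well: any prime `q ≠ p`);
* `diamondOp_pStabilised`, `pStabilised_mem_nebentypusSubspace` — `F ∈ S_k(Np, χ')`, `χ'` the
  character modulo `Np` induced by `χ`;
* `cuspCoeff_pStabilised` — `a_n(F) = a_n(f) - β 𝟙_{p ∣ n} a_{n/p}(f)`; in particular
  `a_1(F) = a_1(f)` (`cuspCoeff_pStabilised_one`), so `F ≠ 0` for a normalised `f`.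

Everything is read off the tree's commutation rules of `T_q`, `U_p`, `⟨d⟩` with the degeneracy
maps (`NewformsSpanGamma1Proofs`: `heckeT_degeneracyMap1_of_not_dvd`, `heckeT_degeneracyMap1_mul`,
`heckeT_degeneracyMap1_of_dvd_of_not_dvd`, packaged as `heckeT_degeneracyMap1_one_and_self` in
`PrimeLevelEigenpacketNewformProofs`; `diamondOp_degeneracyMap1`; `cuspCoeff_degeneracyMap1`).

## References

* A. Wiles, *On ordinary `λ`-adic representations associated to modular forms*, Invent. Math. 94
  (1988), 529–573, p. 538. [Wiles1988]
* F. Diamond, J. Shurman, *A First Course in Modular Forms*, GTM 228 (2005), Prop. 5.6.2.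
  [DiamondShurman2005]
* P. B. Allen, *Modularity of nearly ordinary 2-adic residually dihedral Galois representations*,
  Compos. Math. 150 (2014), Lemma 87 (arXiv:1301.1113v2, §5.1.1, p. 70: "we replace `f₁` with the
  `v`-stabilized eigenform … `T_{ϖ_v} f₁ = χ_v(ϖ_v) f₁`"). [Allen2014]
-/

noncomputable section

open scoped MatrixGroups ModularForm

open CongruenceSubgroup

namespace Literature.NumberTheory.EllipticCurves.ModularForms

/-- The scalar identity behind the `p`-stabilisation: `β p^{1-k} · p^{k-1} = β`. [folklore] -/
private theorem beta_mul_zpow_mul_zpow {p : ℕ} {k : ℤ} (hp : p.Prime) (β : ℂ) :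
    β * (p : ℂ) ^ (1 - k) * (p : ℂ) ^ (k - 1) = β := by
  have hp0 : (p : ℂ) ≠ 0 := Nat.cast_ne_zero.mpr hp.ne_zero
  rw [mul_assoc, ← zpow_add₀ hp0, show (1 - k) + (k - 1) = 0 by ring, zpow_zero, mul_one]

section PStabilisation

variable {N p : ℕ} [NeZero N] [NeZero p] {k : ℤ}

/-- **`U_p` on the `p`-stabilisation.**  For `f ∈ S_k(Γ₁(N))` with `T_p f = a f`, `⟨p⟩ f = c f`
(`p ∤ N` prime) and `β` with `β² - a β + c p^{k-1} = 0`, the form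
`F = [α_1] f - β p^{1-k} [α_p] f ∈ S_k(Γ₁(Np))` satisfies `U_p F = (a - β) F`
(Diamond–Shurman Prop. 5.6.2: `U_p [α_1] f = a [α_1] f - c [α_p] f`, `U_p [α_p] f = p^{k-1} [α_1] f`).
[cite: DiamondShurman2005, Prop. 5.6.2] [cite: Wiles1988, p. 538] -/
theorem heckeT_pStabilised (hp : p.Prime) (hpN : ¬ p ∣ N) {f : CuspForm (Gamma1 N) k} {a c β : ℂ}
    (hT : heckeT (Gamma1 N) k p f = a • f) (hD : diamondOp N k (p : ZMod N) f = c • f)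
    (hβ : β ^ 2 - a * β + c * (p : ℂ) ^ (k - 1) = 0) :
    heckeT (Gamma1 (N * p)) k p
        (degeneracyMap1 N (N * p) 1 k f - (β * (p : ℂ) ^ (1 - k)) • degeneracyMap1 N (N * p) p k f) =
      (a - β) •
        (degeneracyMap1 N (N * p) 1 k f - (β * (p : ℂ) ^ (1 - k)) • degeneracyMap1 N (N * p) p k f) := by
  obtain ⟨h1, hM⟩ := heckeT_degeneracyMap1_one_and_self hp hpN hT hD
  set v₁ := degeneracyMap1 N (N * p) 1 k f
  set vp := degeneracyMap1 N (N * p) p k f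
  have hp0 : (p : ℂ) ≠ 0 := Nat.cast_ne_zero.mpr hp.ne_zero
  -- `(a - β) β p^{1-k} = c`
  have hc : (a - β) * (β * (p : ℂ) ^ (1 - k)) = c := by
    have h1 : (a - β) * β = c * (p : ℂ) ^ (k - 1) := by linear_combination -hβ
    calc (a - β) * (β * (p : ℂ) ^ (1 - k)) = ((a - β) * β) * (p : ℂ) ^ (1 - k) := by ring
      _ = c * ((p : ℂ) ^ (k - 1) * (p : ℂ) ^ (1 - k)) := by rw [h1, mul_assoc]
      _ = c := by rw [← zpow_add₀ hp0, show (k - 1) + (1 - k) = 0 by ring, zpow_zero, mul_one]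
  rw [map_sub, map_smul, h1, hM, smul_smul, beta_mul_zpow_mul_zpow hp β, smul_sub, smul_smul, hc,
    sub_smul]
  abel

/-- **`T_q` (any prime `q ≠ p`) commutes with the `p`-stabilisation**: if `T_q f = b f` then
`T_q F = b F` (for `q ∣ N` this is `U_q`; Diamond–Shurman Prop. 5.6.2, first diagram).
[cite: DiamondShurman2005, Prop. 5.6.2] -/
theorem heckeT_pStabilised_of_ne (hp : p.Prime) {q : ℕ} [NeZero q] (hq : q.Prime) (hqp : q ≠ p)
    {f : CuspForm (Gamma1 N) k} {b : ℂ} (γ : ℂ) (hTq : heckeT (Gamma1 N) k q f = b • f) :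
    heckeT (Gamma1 (N * p)) k q
        (degeneracyMap1 N (N * p) 1 k f - γ • degeneracyMap1 N (N * p) p k f) =
      b • (degeneracyMap1 N (N * p) 1 k f - γ • degeneracyMap1 N (N * p) p k f) := by
  have hq1 : ¬ q ∣ 1 := hq.not_dvd_one
  have hqp' : ¬ q ∣ p := fun h ↦ hqp ((Nat.prime_dvd_prime_iff_eq hq hp).mp h)
  have hiff : q ∣ N ↔ q ∣ N * p :=
    ⟨fun h ↦ h.mul_right p, fun h ↦ (hq.dvd_mul.mp h).resolve_right hqp'⟩
  have hN1 : N * 1 ∣ N * p := by rw [mul_one]; exact dvd_mul_right N p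
  rw [map_sub, map_smul, heckeT_degeneracyMap1_of_not_dvd k hN1 hq hq1 hiff f,
    heckeT_degeneracyMap1_of_not_dvd k dvd_rfl hq hqp' hiff f, hTq, map_smul, map_smul, smul_sub,
    smul_comm b γ]

/-- **Diamond operators commute with the `p`-stabilisation**: for a unit `u` modulo `Np`,
`⟨u⟩ F = [α_1] (⟨u⟩ f) - γ [α_p] (⟨u⟩ f)` (Diamond–Shurman Prop. 5.6.2 with `T = ⟨u⟩`).
[cite: DiamondShurman2005, Prop. 5.6.2] -/
theorem diamondOp_pStabilised (u : (ZMod (N * p))ˣ) (f : CuspForm (Gamma1 N) k) (γ : ℂ) :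
    diamondOp (N * p) k (u : ZMod (N * p))
        (degeneracyMap1 N (N * p) 1 k f - γ • degeneracyMap1 N (N * p) p k f) =
      degeneracyMap1 N (N * p) 1 k
          (diamondOp N k (ZMod.castHom (dvd_mul_right N p) (ZMod N) (u : ZMod (N * p))) f) -
        γ • degeneracyMap1 N (N * p) p k
          (diamondOp N k (ZMod.castHom (dvd_mul_right N p) (ZMod N) (u : ZMod (N * p))) f) := by
  have hN1 : N * 1 ∣ N * p := by rw [mul_one]; exact dvd_mul_right N p
  rw [map_sub, map_smul, diamondOp_degeneracyMap1 (N * p) k hN1 u.isUnit f,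
    diamondOp_degeneracyMap1 (N * p) k dvd_rfl u.isUnit f]

/-- **The `p`-stabilisation of a form in `S_k(N, χ)` lies in `S_k(Np, χ')`**, `χ'` the character
modulo `Np` induced by `χ`. [cite: DiamondShurman2005, Prop. 5.6.2] -/
theorem pStabilised_mem_nebentypusSubspace {χ : DirichletCharacter ℂ N} {f : CuspForm (Gamma1 N) k}
    (hf : f ∈ nebentypusSubspace N k χ) (γ : ℂ) :
    degeneracyMap1 N (N * p) 1 k f - γ • degeneracyMap1 N (N * p) p k f ∈
      nebentypusSubspace (N * p) k (DirichletCharacter.changeLevel (dvd_mul_right N p) χ) := by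
  rw [mem_nebentypusSubspace_iff_diamondOp] at hf ⊢
  intro u
  obtain ⟨u₁, hu₁⟩ := u.isUnit.map (ZMod.castHom (dvd_mul_right N p) (ZMod N))
  rw [diamondOp_pStabilised u f γ, ← hu₁, hf u₁, map_smul, map_smul, smul_comm γ, ← smul_sub,
    DirichletCharacter.changeLevel_eq_cast_of_dvd χ (dvd_mul_right N p) u, hu₁, ZMod.castHom_apply]

/-- **Fourier coefficients of the `p`-stabilisation**:
`a_n([α_1] f - β p^{1-k} [α_p] f) = a_n(f) - β 𝟙_{p ∣ n} a_{n/p}(f)`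
(`a_n([α_p] f) = p^{k-1} 𝟙_{p ∣ n} a_{n/p}(f)`, `cuspCoeff_degeneracyMap1`). [cite: DiamondShurman2005, §5.7 p. 211] -/
theorem cuspCoeff_pStabilised (hp : p.Prime) (f : CuspForm (Gamma1 N) k) (β : ℂ) (n : ℕ) :
    cuspCoeff (degeneracyMap1 N (N * p) 1 k f - (β * (p : ℂ) ^ (1 - k)) • degeneracyMap1 N (N * p) p k f) n =
      cuspCoeff f n - β * (if p ∣ n then cuspCoeff f (n / p) else 0) := by
  have hN1 : N * 1 ∣ N * p := by rw [mul_one]; exact dvd_mul_right N p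
  rw [cuspCoeff_sub_gamma1, cuspCoeff_smul_gamma1, cuspCoeff_degeneracyMap1 hN1,
    cuspCoeff_degeneracyMap1 dvd_rfl, Nat.cast_one, one_zpow, one_mul, if_pos (one_dvd n),
    Nat.div_one, ← mul_assoc, beta_mul_zpow_mul_zpow hp β]

/-- In particular `a_1(F) = a_1(f)`. [folklore] -/
theorem cuspCoeff_pStabilised_one (hp : p.Prime) (f : CuspForm (Gamma1 N) k) (β : ℂ) :
    cuspCoeff (degeneracyMap1 N (N * p) 1 k f - (β * (p : ℂ) ^ (1 - k)) • degeneracyMap1 N (N * p) p k f) 1 =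
      cuspCoeff f 1 := by
  rw [cuspCoeff_pStabilised hp f β 1, if_neg hp.not_dvd_one, mul_zero, sub_zero]

/-- **The `p`-stabilisation, assembled** (Wiles 1988, p. 538; Diamond–Shurman Prop. 5.6.2).  Let
`f ∈ S_k(N, χ)` be an eigenvector of `T_p` (`p ∤ N` prime), `T_p f = a f`, and of the `T_q` for the
primes `q ∤ Np`; let `α + β = a`, `α β = χ(p) p^{k-1}`.  Then there is `F ∈ S_k(Np, χ')` with
`U_p F = α F`, `T_q F = b_q F` whenever `T_q f = b_q f` (`q ≠ p` prime), and
`a_n(F) = a_n(f) - β 𝟙_{p∣n} a_{n/p}(f)` for all `n` (so `a_1(F) = a_1(f)`).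
[cite: Wiles1988, p. 538] [cite: DiamondShurman2005, Prop. 5.6.2] -/
theorem exists_pStabilised (hp : p.Prime) (hpN : ¬ p ∣ N) {χ : DirichletCharacter ℂ N}
    {f : CuspForm (Gamma1 N) k} (hf : f ∈ nebentypusSubspace N k χ) {a α β : ℂ}
    (hT : heckeT (Gamma1 N) k p f = a • f) (hαβ : α + β = a) (hαβ' : α * β = χ p * (p : ℂ) ^ (k - 1)) :
    ∃ F : CuspForm (Gamma1 (N * p)) k,
      F ∈ nebentypusSubspace (N * p) k (DirichletCharacter.changeLevel (dvd_mul_right N p) χ) ∧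
      heckeT (Gamma1 (N * p)) k p F = α • F ∧
      (∀ (q : ℕ) (hq : q.Prime), q ≠ p → ∀ b : ℂ,
        (haveI : NeZero q := ⟨hq.ne_zero⟩; heckeT (Gamma1 N) k q f) = b • f →
        (haveI : NeZero q := ⟨hq.ne_zero⟩; heckeT (Gamma1 (N * p)) k q F) = b • F) ∧
      ∀ n, cuspCoeff F n = cuspCoeff f n - β * (if p ∣ n then cuspCoeff f (n / p) else 0) := by
  have hu : IsUnit ((p : ℕ) : ZMod N) := (ZMod.isUnit_prime_iff_not_dvd hp).mpr hpN
  obtain ⟨u, hu'⟩ := hu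
  have hD : diamondOp N k (p : ZMod N) f = χ p • f := by
    have h := (mem_nebentypusSubspace_iff_diamondOp.mp hf) u
    rwa [hu'] at h
  have hβ : β ^ 2 - a * β + χ p * (p : ℂ) ^ (k - 1) = 0 := by
    rw [← hαβ, ← hαβ']; ring
  refine ⟨degeneracyMap1 N (N * p) 1 k f - (β * (p : ℂ) ^ (1 - k)) • degeneracyMap1 N (N * p) p k f,
    pStabilised_mem_nebentypusSubspace hf _, ?_, fun q hq hqp b hTq ↦ ?_,
    cuspCoeff_pStabilised hp f β⟩
  · have h := heckeT_pStabilised hp hpN hT hD hβ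
    rwa [show a - β = α by rw [← hαβ]; ring] at h
  · haveI : NeZero q := ⟨hq.ne_zero⟩
    exact heckeT_pStabilised_of_ne hp hq hqp _ hTq

end PStabilisation

end Literature.NumberTheory.EllipticCurves.ModularForms

end
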